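import Mathlib
import Summits.Ventures.HodgeRepro2.T5RecordSatakeDifferentDatum

/-!
# FOR EVERY CM FIELD: AN EXPLICIT FINITE EXCEPTIONAL SET, DATUM-FREE

Tier-5 support N3 / §G-N4.2 (seat p3, gen 82). Files 313 and 315 bound the exceptional set of the record's Hecke
commutativity through the relative different and the integral datum `(d, x)` of file 235. This file states the
result for a CM field `K` alone, the datum chosen inside the proof:

* `exists_integer_datum_ne_zero` — the integral datum exists with `d ≠ 0`;
* **`recordPolynomial_of_four_mul_notMem`** — `k[X]` at every non-split place `v` of `K⁺` with `4d ∉ v` (good for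
  `H`); **`recordPolynomial_of_four_mul_notMem_integral`** — the same for an integral unimodular `H`;
* **`exists_ne_zero_subset_setOf_four_mul_mem`** — FOR EVERY CM FIELD `K` AND EVERY INTEGRAL UNIMODULAR HERMITIAN `H`
  THERE IS `d ≠ 0` IN `𝓞_{K⁺}` SUCH THAT THE RECORD'S SPHERICAL HECKE ALGEBRA IS COMMUTATIVE AT EVERY PLACE OF `K⁺`
  NOT DIVIDING `(4d)` — R9's «some finite set» with an explicit description, for every CM field;
  `exists_finite_setOf_not_recordCommutative` (the finite form).

§8(d): uses an L-value-free non-vanishing device: NO.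
-/

open Matrix NumberField NumberField.IsCMField IsDedekindDomain IsDedekindDomain.HeightOneSpectrum Module Polynomial
  Ideal
open scoped TensorProduct Pointwise
open Summit.Ventures.HodgeRepro2.T5UnitaryGroupForm Summit.Ventures.HodgeRepro2.T5UnitaryHeckeAdjoint
  Summit.Ventures.HodgeRepro2.T5HeckePermutationModule Summit.Ventures.HodgeRepro2.T5HeckeDoubleCoset
  Summit.Ventures.HodgeRepro2.T5RecordHyperspecial Summit.Ventures.HodgeRepro2.T5GlobalLatticeAlmostAll
  Summit.Ventures.HodgeRepro2.T5FinitePlaceSplitClassification Summit.Ventures.HodgeRepro2.T5RecordSatakeIntrinsic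
  Summit.Ventures.HodgeRepro2.T5SplitPlaceUnitaryGroup Summit.Ventures.HodgeRepro2.T5NonSplitPlaceUnitaryGroup
  Summit.Ventures.HodgeRepro2.T5FinitePlaceCM Summit.Ventures.HodgeRepro2.T5StarOfInvolution
  Summit.Ventures.HodgeRepro2.T5CyclotomicSubfieldHeckeCommutative
  Summit.Ventures.HodgeRepro2.T5IntegralGramBadSet Summit.Ventures.HodgeRepro2.T5RecordSatakeDifferent
  Summit.Ventures.HodgeRepro2.T5CMFieldSquareDatum Summit.Ventures.HodgeRepro2.T5RecordSatakeDifferentDatum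

namespace Summit.Ventures.HodgeRepro2.T5RecordSatakeDifferentSummary

variable (K : Type*) [Field K] [NumberField K] [IsCMField K]

/-- **The integral datum exists with `d ≠ 0`** (file 235's `exists_integer_sq_eq_and_complexConj_ne`; `x ≠ 0`
because `c(x) ≠ x`, and `d = x²`). -/
theorem exists_integer_datum_ne_zero :
    ∃ (d : 𝓞 (maximalRealSubfield K)) (x : 𝓞 K),
      algebraMap (maximalRealSubfield K) K
          (algebraMap (𝓞 (maximalRealSubfield K)) (maximalRealSubfield K) d) = (algebraMap (𝓞 K) K x) ^ 2 ∧
      complexConj K (algebraMap (𝓞 K) K x) ≠ algebraMap (𝓞 K) K x ∧ d ≠ 0 := by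
  obtain ⟨d, x, hdx, hx⟩ := exists_integer_sq_eq_and_complexConj_ne K
  refine ⟨d, x, hdx, hx, fun hd => hx ?_⟩
  have hx0 : x = 0 := by
    have h := sq_eq K d x hdx
    rw [hd, map_zero] at h
    exact pow_eq_zero_iff two_ne_zero |>.mp h
  rw [hx0, map_zero, map_zero]

section Places

variable (d : 𝓞 (maximalRealSubfield K)) (x : 𝓞 K)
  (hdx : algebraMap (maximalRealSubfield K) K (algebraMap (𝓞 (maximalRealSubfield K)) (maximalRealSubfield K) d) =
    (algebraMap (𝓞 K) K x) ^ 2)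
  (hx : complexConj K (algebraMap (𝓞 K) K x) ≠ algebraMap (𝓞 K) K x)
variable (v : HeightOneSpectrum (𝓞 (maximalRealSubfield K)))
variable {r : ℕ} (l : Fin r → 𝓞 K) (k : Type*) [Field k]
  (hl : Submodule.span (𝓞 (maximalRealSubfield K)) (Set.range l) = ⊤)

include hdx hx hl in
/-- **`k[X]` at every non-split place `v` of `K⁺` with `4d ∉ v`** (good for `H`): the place `w ∣ v` does not divide
the different (file 315) and `v` has one prime above it (file 313). -/
theorem recordPolynomial_of_four_mul_notMem (hv : 4 * d ∉ v.asIdeal)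
    (h1 : (v.asIdeal.primesOver (𝓞 K)).ncard = 1)
    {H : Matrix (Fin 3) (Fin 3) K} (hH : H.IsHermitian) (hdet : IsUnit H.det)
    (hbad : ∀ w : HeightOneSpectrum (𝓞 K), w.asIdeal.LiesOver v.asIdeal → w ∉ badSet H) :
    RecordPolynomial K v l k H := by
  obtain ⟨P, hP, hPv⟩ := (Ideal.nonempty_primesOver (S := 𝓞 K) v.asIdeal).some
  haveI := hP
  haveI := hPv
  let w : HeightOneSpectrum (𝓞 K) := ⟨P, hP, Ideal.ne_bot_of_liesOver_of_ne_bot v.ne_bot P⟩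
  haveI : w.asIdeal.LiesOver v.asIdeal := hPv
  have hw : ¬ w.asIdeal ∣ differentIdeal (𝓞 (maximalRealSubfield K)) (𝓞 K) :=
    not_dvd_differentIdeal_of_notMem K d x hdx hx w (by rw [← hPv.over]; exact hv)
  exact recordPolynomial_of_not_dvd_differentIdeal K v l k w hw h1 hl hH hdet (hbad w hPv)

include hdx hx hl in
/-- The same for an integral unimodular `H = M.map ι` (file 311). -/
theorem recordPolynomial_of_four_mul_notMem_integral (hv : 4 * d ∉ v.asIdeal)
    (h1 : (v.asIdeal.primesOver (𝓞 K)).ncard = 1)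
    (M : Matrix (Fin 3) (Fin 3) (𝓞 K)) (hM : IsUnit M.det)
    (hH : ((algebraMap (𝓞 K) K).mapMatrix M).IsHermitian) :
    RecordPolynomial K v l k ((algebraMap (𝓞 K) K).mapMatrix M) :=
  recordPolynomial_of_four_mul_notMem K d x hdx hx v l k hl hv h1 hH (isUnit_det_mapMatrix M hM)
    (forall_notMem_badSet_mapMatrix v M hM)

end Places

section Summary

variable {r : ℕ} (l : Fin r → 𝓞 K) (k : Type*) [Field k]
  (hl : Submodule.span (𝓞 (maximalRealSubfield K)) (Set.range l) = ⊤)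
variable (M : Matrix (Fin 3) (Fin 3) (𝓞 K)) (hM : IsUnit M.det)
  (hH : ((algebraMap (𝓞 K) K).mapMatrix M).IsHermitian)

include hl hM hH in
/-- **FOR EVERY CM FIELD `K` AND EVERY INTEGRAL UNIMODULAR HERMITIAN `H`: SOME `d ≠ 0` IN `𝓞_{K⁺}` HAS THE RECORD'S
SPHERICAL HECKE ALGEBRA COMMUTATIVE AT EVERY PLACE OF `K⁺` NOT DIVIDING `(4d)`** — file 234's finite exceptional set,
explicit (the datum of file 235 chosen here; file 315's bound). -/
theorem exists_ne_zero_subset_setOf_four_mul_mem :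
    ∃ d : 𝓞 (maximalRealSubfield K), d ≠ 0 ∧
      {v : HeightOneSpectrum (𝓞 (maximalRealSubfield K)) |
          ¬ RecordCommutative K v l k ((algebraMap (𝓞 K) K).mapMatrix M)} ⊆
        {v : HeightOneSpectrum (𝓞 (maximalRealSubfield K)) | 4 * d ∈ v.asIdeal} := by
  obtain ⟨d, x, hdx, hx, hd⟩ := exists_integer_datum_ne_zero K
  exact ⟨d, hd, subset_setOf_four_mul_mem K d x hdx hx l k hl M hM hH⟩

include hl hM hH in
/-- **The exceptional set is finite, with the explicit bound above** — the datum-free form of file 313's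
`finite_setOf_not_recordCommutative`. -/
theorem exists_finite_setOf_not_recordCommutative :
    ∃ d : 𝓞 (maximalRealSubfield K), d ≠ 0 ∧
      {v : HeightOneSpectrum (𝓞 (maximalRealSubfield K)) | 4 * d ∈ v.asIdeal}.Finite ∧
      {v : HeightOneSpectrum (𝓞 (maximalRealSubfield K)) |
          ¬ RecordCommutative K v l k ((algebraMap (𝓞 K) K).mapMatrix M)} ⊆
        {v : HeightOneSpectrum (𝓞 (maximalRealSubfield K)) | 4 * d ∈ v.asIdeal} := by
  obtain ⟨d, hd, hsub⟩ := exists_ne_zero_subset_setOf_four_mul_mem K l k hl M hM hH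
  exact ⟨d, hd, finite_setOf_four_mul_mem K d hd, hsub⟩

end Summary

end Summit.Ventures.HodgeRepro2.T5RecordSatakeDifferentSummary
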